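import Summits.BirchSwinnertonDyer.BirchSwinnertonDyer.Theorems.BiquadraticEisensteinDescentHeegnerTwistCouplingInSupplySymbolicMonskyEvenDesign
import Summits.BirchSwinnertonDyer.BirchSwinnertonDyer.Theorems.BiquadraticEisensteinDescentHeegnerTwistCouplingInSupplySymbolicMonskyDesignExists
import HarnessLib

set_option linter.dupNamespace false -- `Summit.BirchSwinnertonDyer.BirchSwinnertonDyer.Theorems.…` (summit = sub)
set_option autoImplicit false

/-!
# Crux `HeegnerTwistCouplingInSupply` (stmt-BirchSwinnertonDyer-21381) — ★★ EVEN THEOREM A: UNIFORM EXISTENCE of pattern-free Heegner recipes on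
# the EVEN bases `E_{2·P₀⋯P_k}` at `t = t₀^{ev}` (every `k`, every base whose even pencil meets the three coordinate planes in half its dimension)

Route `BiquadraticEisensteinDescent` (cell `pub/bsd-wall`, width seat `bsd-wall-cm-bed-w3` g23; `--supports` 21381, helper). Capstone of the even
design files `…SymbolicMonskyEvenDesignRows/Core/Design` (this session) with the `𝔽₂` transversality theorem `…SymbolicMonskyTransversal`
(w3 g22, p740643); the even twin of THEOREM A `…SymbolicMonskyDesignExists.exists_patternFree_design` (p742384).

★★ `exists_patternFree_even_design`. Let `base : SymbData (k+1)` be ANY base datum (primes `P₀ … P_k`; the base is the EVEN congruent number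
`n₀ = 2·P₀⋯P_k`), `δ ∈ 𝔽₂^(k+1)`, and `W ≤ V × V` the EVEN PENCIL `{(v + ⟨m,u⟩(1+δ) + γδ, u + γ(1+δ)) : (u,v) ∈ 𝒦_ev, γ ∈ 𝔽₂}` of the even
virtual kernel `𝒦_ev = {(u,v) : Lu + m⟨m,u⟩ + D_d u + D_m v = 0, D_d u + Lv + D_m v + D_d v + ⟨m,u⟩m = 0}` (= memo THEOREM-A-w3g22 §6b's left-kernel
pencil `W_ev`: by the duality of `…EvenDesignCore` the even left pairs `(λ,μ)` are the kernel pairs `(μ,λ)`). `W` is given by a MEMBERSHIP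
CHARACTERISATION `hW` (no definition is introduced; a reviewed `Defs` file can instantiate it later), `hlegit` says the generator `(δ, 1+δ)` is honest.
If `finrank W = 2τ` and `W` meets `V × 0`, `0 × V` and the diagonal in dimension `≤ τ` each, THEN there are `τ` free cells `rest` and the
Heegner-forced cell `c₁` with `heegnerK base (c₁ :: rest)` and `det M_even(base, c₁ :: rest, pat) = 1` for EVERY mutual pattern `pat` — a
PATTERN-FREE HEEGNER RECIPE WITH `τ + 1` AUXILIARY PRIMES for `E_{2·P₀⋯P_k}`. Numerics (memo §6b): ALL 128 / 4096 even root-number-`−1` bases with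
`K = 3 / 4` satisfy the hypotheses at `τ = τ₀^{ev} = s*_ev/2` (no exceptional class there; 2500/2500 criterion checks `K ≤ 6`).
Proof: `Transversal.exists_dual_family_separating_prod` gives `τ` forms separating `W`; their coordinate vectors are the free cells, `f_i(δ)` the
`(2/·)`-classes; bijectivity of `w ↦ (f_i(w.1), f_i(w.2))_i` on `W` is (span) + (inj) of `even_design_recipe`.

HONEST FRAMING: RUNG-LEVEL corner layer (even congruent `j = 1728` families); an existence theorem about Monsky matrices — instances of the crux still
need located primes (`RealisesK.cruxOn_even_of_BT_of_forall`) and the print input (Burungale–Tian); the even EXCEPTIONAL class (if any at larger `K`)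
is not covered; the crux as stated (C⁺), its registered stubs and BSD are NOT touched; nothing is closed. THEOREMS ONLY.
Reference: [HeathBrown1994] D. R. Heath-Brown, Invent. Math. 118 (1994) 331–370, appendix (Monsky), typescript p. 41 L20–L36.
-/

namespace Summit.BirchSwinnertonDyer.BirchSwinnertonDyer.Theorems.SymbolicMonsky

section EvenDesignExists

open Matrix Module

variable {k : ℕ} (base : SymbData (k + 1))

/-- `bz (decide (x = 1)) = x` in `𝔽₂`. -/
private theorem bz_decide_eq_one_ev (x : ZMod 2) : bz (decide (x = 1)) = x := by
  revert x; decide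

/-- `(List.ofFn g).getD i dflt = g i`. -/
private theorem getD_ofFn_ev {α : Type*} {n : ℕ} (g : Fin n → α) (dflt : α) (i : ℕ) (hi : i < n) :
    (List.ofFn g).getD i dflt = g ⟨i, hi⟩ := by
  rw [List.getD_eq_getElem?_getD, List.getElem?_ofFn]
  simp [hi]

/-- ★★ **EVEN THEOREM A — uniform existence of pattern-free Heegner recipes on the EVEN bases `E_{2·P₀⋯P_k}` at `t = t₀^{ev}`.** Let
`base : SymbData (k+1)` be ANY base datum and `δ ∈ 𝔽₂^(k+1)`. Write `𝒦_ev` for the even virtual kernel (pairs `(u, v)` with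
`Lu + m⟨m,u⟩ + D_d u + D_m v = 0` and `D_d u + Lv + D_m v + D_d v + ⟨m,u⟩ m = 0`) and let `W ≤ V × V` be the EVEN PENCIL
`{(v + ⟨m,u⟩(1+δ) + γδ, u + γ(1+δ)) : (u,v) ∈ 𝒦_ev, γ ∈ 𝔽₂}` (hypothesis `hW` characterises `W` by membership, so that no definition is
needed; the generator `(δ, 1+δ)` must be honest: `hlegit`). If `finrank W = 2τ` and `W` meets `V × 0`, `0 × V` and the diagonal in dimension
`≤ τ` each, then there are `τ` free cells `rest` and the Heegner-forced cell `c₁` with `heegnerK base (c₁ :: rest)` and Monsky's EVEN matrix of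
`(base, c₁ :: rest, pat)` invertible for EVERY mutual pattern `pat` — a pattern-free Heegner recipe for `E_{2·P₀⋯P_k}` with `τ + 1` auxiliary
primes. Proof: the transversality theorem `Transversal.exists_dual_family_separating_prod` (p740643) gives `τ` forms separating `W`; their
coordinate vectors are the free cells; bijectivity of `w ↦ (f_i(w.1), f_i(w.2))_i` on `W` is exactly (span) + (inj) of `even_design_recipe`
(the even left pairs `(λ, μ)` are the kernel pairs `(u, v) = (μ, λ)`). Memo THEOREM-A-w3g22 §6b: numerically every even root-number-`−1`
base with `K ≤ 4` (4224 of them) satisfies the hypotheses at `τ = τ₀^{ev} = s*_ev/2`.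
HONEST FRAMING: RUNG-LEVEL corner layer (even congruent `j = 1728` families); instances still need located primes and the print inputs; the
crux as stated (C⁺), its registered stubs and BSD are NOT touched; nothing is closed.
[cite: HeathBrown1994SelmerCongruentII, Appendix (Monsky), typescript p. 41 L20–L36] -/
theorem exists_patternFree_even_design (δ : Fin (k + 1) → ZMod 2) (τ : ℕ)
    (W : Submodule (ZMod 2) ((Fin (k + 1) → ZMod 2) × (Fin (k + 1) → ZMod 2)))
    (hW : ∀ p : (Fin (k + 1) → ZMod 2) × (Fin (k + 1) → ZMod 2), p ∈ W ↔
      ∃ (u v : Fin (k + 1) → ZMod 2) (γ : ZMod 2),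
        (∀ b, (∑ b', bz (base.neg b b') * (u b' + u b)) +
          bz (negNegOne (base.cls b)) * (∑ b', bz (negNegOne (base.cls b')) * u b') +
          bz (negTwo (base.cls b)) * u b + bz (negNegOne (base.cls b)) * v b = 0) ∧
        (∀ b, bz (negTwo (base.cls b)) * u b + (∑ b', bz (base.neg b b') * (v b' + v b)) +
          bz (negNegOne (base.cls b)) * v b + bz (negTwo (base.cls b)) * v b +
          bz (negNegOne (base.cls b)) * (∑ b', bz (negNegOne (base.cls b')) * u b') = 0) ∧
        p = (fun b => v b + (∑ b', bz (negNegOne (base.cls b')) * u b') * (1 + δ b) + γ * δ b,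
             fun b => u b + γ * (1 + δ b)))
    (hlegit : ∀ u v : Fin (k + 1) → ZMod 2,
      (∀ b, (∑ b', bz (base.neg b b') * (u b' + u b)) +
          bz (negNegOne (base.cls b)) * (∑ b', bz (negNegOne (base.cls b')) * u b') +
          bz (negTwo (base.cls b)) * u b + bz (negNegOne (base.cls b)) * v b = 0) →
      (∀ b, bz (negTwo (base.cls b)) * u b + (∑ b', bz (base.neg b b') * (v b' + v b)) +
          bz (negNegOne (base.cls b)) * v b + bz (negTwo (base.cls b)) * v b +
          bz (negNegOne (base.cls b)) * (∑ b', bz (negNegOne (base.cls b')) * u b') = 0) →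
      (∀ b, u b = 1 + δ b) → (∀ b, v b = (∑ b', bz (negNegOne (base.cls b')) * u b') * (1 + δ b) + δ b) → False)
    (hdim : finrank (ZMod 2) ↥W = 2 * τ)
    (h1 : finrank (ZMod 2) ↥(W ⊓ LinearMap.ker (LinearMap.snd (ZMod 2) (Fin (k + 1) → ZMod 2) (Fin (k + 1) → ZMod 2))) ≤ τ)
    (h2 : finrank (ZMod 2) ↥(W ⊓ LinearMap.ker (LinearMap.fst (ZMod 2) (Fin (k + 1) → ZMod 2) (Fin (k + 1) → ZMod 2))) ≤ τ)
    (h3 : finrank (ZMod 2) ↥(W ⊓ LinearMap.ker (LinearMap.fst (ZMod 2) (Fin (k + 1) → ZMod 2) (Fin (k + 1) → ZMod 2) +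
      LinearMap.snd (ZMod 2) (Fin (k + 1) → ZMod 2) (Fin (k + 1) → ZMod 2))) ≤ τ) :
    ∃ (c₁ : AuxCell) (rest : List AuxCell), rest.length = τ ∧ heegnerK base (c₁ :: rest) = true ∧
      ∀ pat : ℕ → ℕ → Bool, (dataK base (c₁ :: rest) pat).monskyEvenS.det = 1 := by
  classical
  obtain ⟨f, hf⟩ := Transversal.exists_dual_family_separating_prod τ W hdim h1 h2 h3
  set σ : Fin τ → Fin (k + 1) → ZMod 2 := fun i b => f i (fun j => if b = j then 1 else 0) with hσdef
  have hfx : ∀ i (x : Fin (k + 1) → ZMod 2), f i x = ∑ b, σ i b * x b := fun i x => dual_apply_eq_sum (f i) x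
  have hxf : ∀ i (x : Fin (k + 1) → ZMod 2), (∑ b, σ i b * x b) = f i x := fun i x => (hfx i x).symm
  have hc : ∀ i, (∑ b, σ i b) = f i (fun _ => 1) := fun i => by
    rw [hfx]; exact Finset.sum_congr rfl fun b _ => by ring
  -- linearity bookkeeping for the pencil elements
  have hf1δ : ∀ i, f i (fun b => 1 + δ b) = f i (fun _ => 1) + f i δ := fun i => by
    have : (fun b => 1 + δ b) = (fun _ => (1 : ZMod 2)) + δ := by funext b; simp
    rw [this, map_add]
  have hfst : ∀ i (v u : Fin (k + 1) → ZMod 2) (γ : ZMod 2),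
      f i (fun b => v b + (∑ b', bz (negNegOne (base.cls b')) * u b') * (1 + δ b) + γ * δ b) =
        f i v + (∑ b', bz (negNegOne (base.cls b')) * u b') * (f i (fun _ => 1) + f i δ) + γ * f i δ := by
    intro i v u γ
    have : (fun b => v b + (∑ b', bz (negNegOne (base.cls b')) * u b') * (1 + δ b) + γ * δ b) =
        v + (∑ b', bz (negNegOne (base.cls b')) * u b') • (fun b => 1 + δ b) + γ • δ := by
      funext b; simp [Pi.add_apply, Pi.smul_apply]
    rw [this, map_add, map_add, map_smul, map_smul, smul_eq_mul, smul_eq_mul, hf1δ]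
  have hsnd : ∀ i (u : Fin (k + 1) → ZMod 2) (γ : ZMod 2),
      f i (fun b => u b + γ * (1 + δ b)) = f i u + γ * (f i (fun _ => 1) + f i δ) := by
    intro i u γ
    have : (fun b => u b + γ * (1 + δ b)) = u + γ • (fun b => 1 + δ b) := by
      funext b; simp [Pi.add_apply, Pi.smul_apply]
    rw [this, map_add, map_smul, smul_eq_mul, hf1δ]
  -- the cells
  set cells : Fin τ → AuxCell := fun i =>
    ((if f i δ = 1 then 2 else 0 : Fin 4), ofBits (List.ofFn fun b : Fin (k + 1) => decide (σ i b = 1))) with hcells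
  set c₁ : AuxCell := ((if (∑ i, f i δ) = 1 then 1 else 3 : Fin 4),
    ofBits (List.ofFn fun b : Fin (k + 1) => xor (negNegOne (base.cls b)) (decide ((∑ i, σ i b) = 1)))) with hc₁
  have hlen : (List.ofFn cells).length = τ := List.length_ofFn
  set e : Fin (List.ofFn cells).length ≃ Fin τ := finCongr hlen with he
  have hget : ∀ i : Fin (List.ofFn cells).length, (List.ofFn cells).getD i.val (0, 0) = cells (e i) := fun i =>
    getD_ofFn_ev cells (0, 0) i.val (lt_of_lt_of_eq i.isLt hlen)
  have hsumσ : ∀ (g : Fin τ → ZMod 2), (∑ i : Fin (List.ofFn cells).length, g (e i)) = ∑ i, g i := fun g =>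
    Fintype.sum_equiv e _ _ (fun _ => rfl)
  refine ⟨c₁, List.ofFn cells, List.length_ofFn, ?_⟩
  refine even_design_recipe base c₁ (List.ofFn cells) ?_ ?_ (fun i b => σ (e i) b) ?_ ?_ (fun i => f (e i) δ) ?_ ?_ ?_ ?_
  · show negNegOne (if (∑ i, f i δ) = 1 then 1 else 3 : Fin 4) = true
    split_ifs <;> rfl
  · intro i; rw [hget]
    show negNegOne (if f (e i) δ = 1 then 2 else 0 : Fin 4) = false
    split_ifs <;> rfl
  · intro i b; rw [hget]
    show bz ((ofBits (List.ofFn fun b : Fin (k + 1) => decide (σ (e i) b = 1))).testBit b.val) = σ (e i) b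
    rw [testBit_ofBits_ofFn, bz_decide_eq_one_ev]
  · intro b
    show bz ((ofBits (List.ofFn fun b : Fin (k + 1) => xor (negNegOne (base.cls b)) (decide ((∑ i, σ i b) = 1)))).testBit b.val) = _
    rw [testBit_ofBits_ofFn, bz_xor_add, bz_decide_eq_one_ev, hsumσ (fun i => σ i b)]
  · intro i; rw [hget]
    show bz (negTwo (if f (e i) δ = 1 then 2 else 0 : Fin 4)) = f (e i) δ
    by_cases h : f (e i) δ = 1
    · rw [if_pos h, h]; rfl
    · rw [if_neg h]
      rcases zmod_two_eq_zero_or_eq_one (f (e i) δ) with h0 | h1'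
      · rw [h0]; rfl
      · exact absurd h1' h
  · show bz (negTwo (if (∑ i, f i δ) = 1 then 1 else 3 : Fin 4)) = ∑ i : Fin (List.ofFn cells).length, f (e i) δ
    rw [hsumσ (fun i => f i δ)]
    by_cases h : (∑ i, f i δ) = 1
    · rw [if_pos h, h]; rfl
    · rw [if_neg h]
      rcases zmod_two_eq_zero_or_eq_one (∑ i, f i δ) with h0 | h1'
      · rw [h0]; rfl
      · exact absurd h1' h
  · -- (span)
    intro a' e' H1 H2
    -- transport to `Fin τ`
    set a : Fin τ → ZMod 2 := fun j => a' (e.symm j) with ha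
    set ee : Fin τ → ZMod 2 := fun j => e' (e.symm j) with hee
    -- the evaluation map on W
    let ρ : ↥W →ₗ[ZMod 2] (Fin τ → ZMod 2) × (Fin τ → ZMod 2) :=
      LinearMap.prod
        (LinearMap.pi fun i => (f i).comp ((LinearMap.fst (ZMod 2) (Fin (k + 1) → ZMod 2) (Fin (k + 1) → ZMod 2)).comp W.subtype))
        (LinearMap.pi fun i => (f i).comp ((LinearMap.snd (ZMod 2) (Fin (k + 1) → ZMod 2) (Fin (k + 1) → ZMod 2)).comp W.subtype))
    have hρ : ∀ w : ↥W, ρ w = (fun i => f i (w : (Fin (k + 1) → ZMod 2) × (Fin (k + 1) → ZMod 2)).1,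
        fun i => f i (w : (Fin (k + 1) → ZMod 2) × (Fin (k + 1) → ZMod 2)).2) := fun w => rfl
    have hinj : Function.Injective ρ := by
      rw [← LinearMap.ker_eq_bot, LinearMap.ker_eq_bot']
      intro w hw
      rw [hρ] at hw
      have h1' : ∀ i, f i (w : (Fin (k + 1) → ZMod 2) × (Fin (k + 1) → ZMod 2)).1 = 0 := fun i => by
        have := congrArg (fun q => q.1 i) hw; simpa using this
      have h2' : ∀ i, f i (w : (Fin (k + 1) → ZMod 2) × (Fin (k + 1) → ZMod 2)).2 = 0 := fun i => by
        have := congrArg (fun q => q.2 i) hw; simpa using this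
      exact Subtype.ext (hf w w.2 h1' h2')
    have hrank : finrank (ZMod 2) ↥W = finrank (ZMod 2) ((Fin τ → ZMod 2) × (Fin τ → ZMod 2)) := by
      rw [hdim, Module.finrank_prod, Module.finrank_fintype_fun_eq_card, Fintype.card_fin]; ring
    have hsurj : Function.Surjective ρ := (LinearMap.injective_iff_surjective_of_finrank_eq_finrank hrank).mp hinj
    -- Φ(w) = Σ_i (a_i f_i(w.1) + e_i f_i(w.2)) vanishes on W
    have hΦ : ∀ w : ↥W, (∑ i, (a i * f i (w : (Fin (k + 1) → ZMod 2) × (Fin (k + 1) → ZMod 2)).1 +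
        ee i * f i (w : (Fin (k + 1) → ZMod 2) × (Fin (k + 1) → ZMod 2)).2)) = 0 := by
      intro w
      obtain ⟨u, v, γ, hE1, hE2, hw⟩ := (hW w).1 w.2
      -- (λ, μ) := (v, u) is an even left pair
      have hH1 : (∑ i, (a i * (f i v + (∑ b', bz (negNegOne (base.cls b')) * u b') * (f i (fun _ => 1) + f i δ)) + ee i * f i u)) = 0 := by
        rw [← hsumσ]
        simpa only [ha, hee, Equiv.symm_apply_apply, hxf, hc] using
          H1 v u (fun b => by linear_combination hE2 b) (fun b => by linear_combination hE1 b)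
      have hH2 : (∑ i, (f i δ * a i + (f i (fun _ => 1) + f i δ) * ee i)) = 0 := by
        rw [← hsumσ]
        simpa only [ha, hee, Equiv.symm_apply_apply, hc] using H2
      have e1 : ∀ i, f i (w : (Fin (k + 1) → ZMod 2) × (Fin (k + 1) → ZMod 2)).1 =
          f i v + (∑ b', bz (negNegOne (base.cls b')) * u b') * (f i (fun _ => 1) + f i δ) + γ * f i δ := fun i => by
        rw [hw]; exact hfst i v u γ
      have e2 : ∀ i, f i (w : (Fin (k + 1) → ZMod 2) × (Fin (k + 1) → ZMod 2)).2 = f i u + γ * (f i (fun _ => 1) + f i δ) :=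
        fun i => by rw [hw]; exact hsnd i u γ
      simp only [e1, e2]
      have : (∑ i, (a i * (f i v + (∑ b', bz (negNegOne (base.cls b')) * u b') * (f i (fun _ => 1) + f i δ) + γ * f i δ) +
          ee i * (f i u + γ * (f i (fun _ => 1) + f i δ)))) =
          (∑ i, (a i * (f i v + (∑ b', bz (negNegOne (base.cls b')) * u b') * (f i (fun _ => 1) + f i δ)) + ee i * f i u)) +
            γ * ∑ i, (f i δ * a i + (f i (fun _ => 1) + f i δ) * ee i) := by
        rw [Finset.mul_sum, ← Finset.sum_add_distrib]; exact Finset.sum_congr rfl fun i _ => by ring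
      rw [this, hH1, hH2, mul_zero, add_zero]
    have key : (∀ j, a j = 0) ∧ (∀ j, ee j = 0) := by
      constructor
      · intro j
        obtain ⟨w, hw⟩ := hsurj (Pi.single j 1, 0)
        have hw1 : ∀ i, f i (w : (Fin (k + 1) → ZMod 2) × (Fin (k + 1) → ZMod 2)).1 = if i = j then 1 else 0 := fun i => by
          have := congrArg (fun q => q.1 i) hw; rw [hρ] at this; simpa [Pi.single_apply] using this
        have hw2 : ∀ i, f i (w : (Fin (k + 1) → ZMod 2) × (Fin (k + 1) → ZMod 2)).2 = 0 := fun i => by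
          have := congrArg (fun q => q.2 i) hw; rw [hρ] at this; simpa using this
        have := hΦ w
        simp only [hw1, hw2, mul_zero, add_zero, mul_ite, mul_one, Finset.sum_ite_eq', Finset.mem_univ, if_true] at this
        exact this
      · intro j
        obtain ⟨w, hw⟩ := hsurj (0, Pi.single j 1)
        have hw1 : ∀ i, f i (w : (Fin (k + 1) → ZMod 2) × (Fin (k + 1) → ZMod 2)).1 = 0 := fun i => by
          have := congrArg (fun q => q.1 i) hw; rw [hρ] at this; simpa using this
        have hw2 : ∀ i, f i (w : (Fin (k + 1) → ZMod 2) × (Fin (k + 1) → ZMod 2)).2 = if i = j then 1 else 0 := fun i => by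
          have := congrArg (fun q => q.2 i) hw; rw [hρ] at this; simpa [Pi.single_apply] using this
        have := hΦ w
        simp only [hw1, hw2, mul_zero, zero_add, mul_ite, mul_one, Finset.sum_ite_eq', Finset.mem_univ, if_true] at this
        exact this
    exact ⟨fun i => by simpa [ha] using key.1 (e i), fun i => by simpa [hee] using key.2 (e i)⟩
  · -- (inj)
    intro u v U0 V0 hE1 hE2 hV0 H3 H4
    -- the pencil element
    have hmem : ((fun b => v b + (∑ b', bz (negNegOne (base.cls b')) * u b') * (1 + δ b) + U0 * δ b,
        fun b => u b + U0 * (1 + δ b)) : (Fin (k + 1) → ZMod 2) × (Fin (k + 1) → ZMod 2)) ∈ W := by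
      rw [hW]
      refine ⟨u, v, U0, hE1, fun b => ?_, rfl⟩
      have := hE2 b; rw [hV0] at this; exact this
    have hz := hf _ hmem (fun i => by
        rw [hfst i v u U0]
        have := H4 (e.symm i)
        simp only [Equiv.apply_symm_apply] at this
        rw [hV0] at this
        rw [hfx i v, ← hc i]
        linear_combination this)
      (fun i => by
        rw [hsnd i u U0]
        have := H3 (e.symm i)
        simp only [Equiv.apply_symm_apply] at this
        rw [hfx i u, ← hc i]
        linear_combination this)
    have hu' : ∀ b, u b + U0 * (1 + δ b) = 0 := fun b => by
      have := congrArg (fun p => p.2 b) hz; simpa using this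
    have hv' : ∀ b, v b + (∑ b', bz (negNegOne (base.cls b')) * u b') * (1 + δ b) + U0 * δ b = 0 := fun b => by
      have := congrArg (fun p => p.1 b) hz; simpa using this
    rcases zmod_two_eq_zero_or_eq_one U0 with hU | hU
    · have hu0 : u = 0 := by
        funext b; have := hu' b; rw [hU, zero_mul, add_zero] at this; exact this
      have hV : V0 = 0 := by rw [hV0, hu0]; simp
      refine ⟨hu0, ?_, hU, hV⟩
      funext b
      have := hv' b
      rw [hu0, hU] at this
      simpa using this
    · exfalso
      refine hlegit u v hE1 (fun b => by have := hE2 b; rw [hV0] at this; exact this) (fun b => ?_) (fun b => ?_)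
      · have := hu' b; rw [hU, one_mul] at this
        exact (zmod_two_eq_iff_add_eq_zero _ _).mpr this
      · have := hv' b; rw [hU, one_mul] at this
        exact (zmod_two_eq_iff_add_eq_zero _ _).mpr (by rw [← add_assoc]; exact this)

end EvenDesignExists

end Summit.BirchSwinnertonDyer.BirchSwinnertonDyer.Theorems.SymbolicMonsky
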